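import Summits.AnomalousDissipation.AnomalousDissipation.Theorems.MomentParityQuarticGateAxialQuadBaseA
import Summits.AnomalousDissipation.AnomalousDissipation.Theorems.MomentParityQuarticGateAxialQuadBaseB
import Summits.AnomalousDissipation.AnomalousDissipation.Theorems.MomentParityQuarticGateAxialQuadBaseC

/-!
# Axial quadratic rigidity (stub S2q of line `axis-sectors`, crux `MomentParity.QuarticGate`):
# the centre sector — base of the peeling induction

All 26 wavevectors with `0 < |k|² ≤ 3` are pinned to `(α, β) = ((A_{e₀})₁₁, (A_{e₀})₂₁)`: the seven
certified classes of `…AxialQuadBase{A,B,C}`, their negatives (`pinned_neg`), the three remaining face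
diagonals `eᵢ - eⱼ` by the EQUAL step with the two pairs `{eᵢ, -eⱼ}`, `{eᵢ + eₗ, -(eⱼ + eₗ)}`
(independent polarisations), and the three remaining body diagonals by the UNEQUAL step
`(eᵢ + eⱼ) + (-eₗ)`. This is the base of the induction on `|k|²` in `…AxialQuadCentre`.
-/

namespace Summit.AnomalousDissipation.AnomalousDissipation.Theorems.MomentParityQuarticGate.AxialQuad

open Matrix

-- `Summit.<Summit>.<Problem>` is the tree's mandated summit-side namespace (CONVENTIONS §2); for this
-- single-conjunct summit the two coincide, so the duplicate is deliberate.
set_option linter.dupNamespace false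

variable (Q : (Fin 3 → ℤ) → (Fin 3 → ℤ) → Matrix (Fin 3) (Fin 3) ℂ) {N : ℕ}

/-- **Base of the centre induction.** At level `N ≥ 2`, every wavevector with `0 < |k|² ≤ 3` is
pinned to `(α, β) = ((A_{e₀})₁₁, (A_{e₀})₂₁)`. [folklore] -/
theorem pinned_of_normSq_le_three (hN : 2 ≤ N) (hsymm : ∀ a b, Q b a = (Q a b)ᵀ)
    (hrow : ∀ a b, (fun i : Fin 3 => (((a : Fin 3 → ℤ) i : ℤ) : ℂ)) ᵥ* Q a b = 0) (hcol : ∀ a b, Q a b *ᵥ (fun i : Fin 3 => (((b : Fin 3 → ℤ) i : ℤ) : ℂ)) = 0) (hpol : (∀ (k₁ k₂ k₃ : Fin 3 → ℤ) (v₁ v₂ v₃ : Fin 3 → ℂ), ((k₁ : Fin 3 → ℤ) ≠ 0 ∧ (k₁) ⬝ᵥ (k₁) ≤ ((N : ℕ) : ℤ) ^ 2) → ((k₂ : Fin 3 → ℤ) ≠ 0 ∧ (k₂) ⬝ᵥ (k₂) ≤ ((N : ℕ) : ℤ) ^ 2) → ((k₃ : Fin 3 → ℤ) ≠ 0 ∧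 (k₃) ⬝ᵥ (k₃) ≤ ((N : ℕ) : ℤ) ^ 2) → v₁ ⬝ᵥ (fun i : Fin 3 => (((k₁ : Fin 3 → ℤ) i : ℤ) : ℂ)) = 0 → v₂ ⬝ᵥ (fun i : Fin 3 => (((k₂ : Fin 3 → ℤ) i : ℤ) : ℂ)) = 0 → v₃ ⬝ᵥ (fun i : Fin 3 => (((k₃ : Fin 3 → ℤ) i : ℤ) : ℂ)) = 0 → (((v₁) ⬝ᵥ (fun i : Fin 3 => (((k₂ : Fin 3 → ℤ) i : ℤ) : ℂ))) • (v₂) + ((v₂) ⬝ᵥ (fun i : Fin 3 => (((k₁ : Fin 3 → ℤ) i : ℤ) : ℂ))) • (v₁) : Fin 3 → ℂ) ⬝ᵥ (Q (k₁ + k₂) k₃ *ᵥ v₃) + (((v₁) ⬝ᵥ (fun i : Fin 3 => (((k₃ : Fin 3 → ℤ) i : ℤ) : ℂ))) • (v₃) + ((v₃) ⬝ᵥ (fun i : Fin 3 => (((k₁ : Fin 3 → ℤ) i : ℤ) : ℂ))) • (v₁) : Fin 3 → ℂ) ⬝ᵥ (Q (k₁ + k₃) k₂ *ᵥ v₂)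 + (((v₂) ⬝ᵥ (fun i : Fin 3 => (((k₃ : Fin 3 → ℤ) i : ℤ) : ℂ))) • (v₃) + ((v₃) ⬝ᵥ (fun i : Fin 3 => (((k₂ : Fin 3 → ℤ) i : ℤ) : ℂ))) • (v₂) : Fin 3 → ℂ) ⬝ᵥ (Q (k₂ + k₃) k₁ *ᵥ v₁) = 0))
    (k : Fin 3 → ℤ) (hk : ((k : Fin 3 → ℤ) ≠ 0 ∧ (k) ⬝ᵥ (k) ≤ ((N : ℕ) : ℤ) ^ 2)) (hk3 : k ⬝ᵥ k ≤ 3) :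
    (∀ y : Fin 3 → ℂ, y ⬝ᵥ (fun i : Fin 3 => (((k : Fin 3 → ℤ) i : ℤ) : ℂ)) = 0 → Q (-(k)) (k) *ᵥ y = (Q ![-1, 0, 0] ![1, 0, 0] 1 1) • y + (Q ![-1, 0, 0] ![1, 0, 0] 2 1) • ((fun i : Fin 3 => (((k : Fin 3 → ℤ) i : ℤ) : ℂ)) ⨯₃ y)) := by
  have hN3 : (3 : ℤ) ≤ ((N : ℕ) : ℤ) ^ 2 := by
    have h2 : (2 : ℤ) ≤ (N : ℤ) := by exact_mod_cast hN
    nlinarith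
  have hb : ∀ l : Fin 3 → ℤ, l ≠ 0 → l ⬝ᵥ l ≤ 3 → ((l : Fin 3 → ℤ) ≠ 0 ∧ (l) ⬝ᵥ (l) ≤ ((N : ℕ) : ℤ) ^ 2) := fun l h1 h2 => ⟨h1, h2.trans hN3⟩
  obtain ⟨p_100, p_010⟩ := base_pinned_e₀e₁ Q hN hsymm hrow hcol hpol
  have p_001 := base_pinned_e₂ Q hN hsymm hrow hcol hpol
  have p_111 := base_pinned_diag Q hN hsymm hrow hcol hpol
  -- negatives of the certified classes
  have p_m00 : (∀ y : Fin 3 → ℂ, y ⬝ᵥ (fun i : Fin 3 => (((![-1, 0, 0] : Fin 3 → ℤ) i : ℤ) : ℂ)) = 0 → Q (-(![-1, 0, 0])) (![-1, 0, 0]) *ᵥ y = (Q ![-1, 0, 0] ![1, 0, 0] 1 1) • y + (Q ![-1, 0, 0] ![1, 0, 0] 2 1) • ((fun i : Fin 3 => (((![-1, 0, 0] : Fin 3 → ℤ) i : ℤ) : ℂ)) ⨯₃ y)) := by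
    have h := pinned_neg Q hsymm hcol (k := ![1, 0, 0]) (by decide) p_100
    rwa [show (-![1, 0, 0] : Fin 3 → ℤ) = ![-1, 0, 0] by decide] at h
  have p_0m0 : (∀ y : Fin 3 → ℂ, y ⬝ᵥ (fun i : Fin 3 => (((![0, -1, 0] : Fin 3 → ℤ) i : ℤ) : ℂ)) = 0 → Q (-(![0, -1, 0])) (![0, -1, 0]) *ᵥ y = (Q ![-1, 0, 0] ![1, 0, 0] 1 1) • y + (Q ![-1, 0, 0] ![1, 0, 0] 2 1) • ((fun i : Fin 3 => (((![0, -1, 0] : Fin 3 → ℤ) i : ℤ) : ℂ)) ⨯₃ y)) := by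
    have h := pinned_neg Q hsymm hcol (k := ![0, 1, 0]) (by decide) p_010
    rwa [show (-![0, 1, 0] : Fin 3 → ℤ) = ![0, -1, 0] by decide] at h
  have p_00m : (∀ y : Fin 3 → ℂ, y ⬝ᵥ (fun i : Fin 3 => (((![0, 0, -1] : Fin 3 → ℤ) i : ℤ) : ℂ)) = 0 → Q (-(![0, 0, -1])) (![0, 0, -1]) *ᵥ y = (Q ![-1, 0, 0] ![1, 0, 0] 1 1) • y + (Q ![-1, 0, 0] ![1, 0, 0] 2 1) • ((fun i : Fin 3 => (((![0, 0, -1] : Fin 3 → ℤ) i : ℤ) : ℂ)) ⨯₃ y)) := by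
    have h := pinned_neg Q hsymm hcol (k := ![0, 0, 1]) (by decide) p_001
    rwa [show (-![0, 0, 1] : Fin 3 → ℤ) = ![0, 0, -1] by decide] at h
  have p_mmm : (∀ y : Fin 3 → ℂ, y ⬝ᵥ (fun i : Fin 3 => (((![-1, -1, -1] : Fin 3 → ℤ) i : ℤ) : ℂ)) = 0 → Q (-(![-1, -1, -1])) (![-1, -1, -1]) *ᵥ y = (Q ![-1, 0, 0] ![1, 0, 0] 1 1) • y + (Q ![-1, 0, 0] ![1, 0, 0] 2 1) • ((fun i : Fin 3 => (((![-1, -1, -1] : Fin 3 → ℤ) i : ℤ) : ℂ)) ⨯₃ y)) := by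
    have h := pinned_neg Q hsymm hcol (k := ![1, 1, 1]) (by decide) p_111
    rwa [show (-![1, 1, 1] : Fin 3 → ℤ) = ![-1, -1, -1] by decide] at h
  -- the face diagonals `eᵢ + eⱼ` from the body diagonal and `-eₗ` (unequal step)
  have p_110 : (∀ y : Fin 3 → ℂ, y ⬝ᵥ (fun i : Fin 3 => (((![1, 1, 0] : Fin 3 → ℤ) i : ℤ) : ℂ)) = 0 → Q (-(![1, 1, 0])) (![1, 1, 0]) *ᵥ y = (Q ![-1, 0, 0] ![1, 0, 0] 1 1) • y + (Q ![-1, 0, 0] ![1, 0, 0] 2 1) • ((fun i : Fin 3 => (((![1, 1, 0] : Fin 3 → ℤ) i : ℤ) : ℂ)) ⨯₃ y)) := by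
    have e : (![1, 1, 1] + ![0, 0, -1] : Fin 3 → ℤ) = ![1, 1, 0] := by decide
    have h := pin_sum_unequal Q hsymm hrow hcol hpol (k₁ := ![1, 1, 1]) (k₂ := ![0, 0, -1]) (hb ![1, 1, 1] (by decide) (by rw [vec3_dotProduct]; decide))
      (hb ![0, 0, -1] (by decide) (by rw [vec3_dotProduct]; decide)) (by rw [e]; exact (hb ![1, 1, 0] (by decide) (by rw [vec3_dotProduct]; decide))) (by rw [cross_apply]; decide)
      (by rw [vec3_dotProduct, vec3_dotProduct]; decide) p_111 p_00m
    rwa [e] at h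
  have p_101 : (∀ y : Fin 3 → ℂ, y ⬝ᵥ (fun i : Fin 3 => (((![1, 0, 1] : Fin 3 → ℤ) i : ℤ) : ℂ)) = 0 → Q (-(![1, 0, 1])) (![1, 0, 1]) *ᵥ y = (Q ![-1, 0, 0] ![1, 0, 0] 1 1) • y + (Q ![-1, 0, 0] ![1, 0, 0] 2 1) • ((fun i : Fin 3 => (((![1, 0, 1] : Fin 3 → ℤ) i : ℤ) : ℂ)) ⨯₃ y)) := by
    have e : (![1, 1, 1] + ![0, -1, 0] : Fin 3 → ℤ) = ![1, 0, 1] := by decide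
    have h := pin_sum_unequal Q hsymm hrow hcol hpol (k₁ := ![1, 1, 1]) (k₂ := ![0, -1, 0]) (hb ![1, 1, 1] (by decide) (by rw [vec3_dotProduct]; decide))
      (hb ![0, -1, 0] (by decide) (by rw [vec3_dotProduct]; decide)) (by rw [e]; exact (hb ![1, 0, 1] (by decide) (by rw [vec3_dotProduct]; decide))) (by rw [cross_apply]; decide)
      (by rw [vec3_dotProduct, vec3_dotProduct]; decide) p_111 p_0m0
    rwa [e] at h
  have p_011 : (∀ y : Fin 3 → ℂ, y ⬝ᵥ (fun i : Fin 3 => (((![0, 1, 1] : Fin 3 → ℤ) i : ℤ) : ℂ)) = 0 → Q (-(![0, 1, 1])) (![0, 1, 1]) *ᵥ y = (Q ![-1, 0, 0] ![1, 0, 0] 1 1) • y + (Q ![-1, 0, 0] ![1, 0, 0] 2 1) • ((fun i : Fin 3 => (((![0, 1, 1] : Fin 3 → ℤ) i : ℤ) : ℂ)) ⨯₃ y)) := by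
    have e : (![1, 1, 1] + ![-1, 0, 0] : Fin 3 → ℤ) = ![0, 1, 1] := by decide
    have h := pin_sum_unequal Q hsymm hrow hcol hpol (k₁ := ![1, 1, 1]) (k₂ := ![-1, 0, 0]) (hb ![1, 1, 1] (by decide) (by rw [vec3_dotProduct]; decide))
      (hb ![-1, 0, 0] (by decide) (by rw [vec3_dotProduct]; decide)) (by rw [e]; exact (hb ![0, 1, 1] (by decide) (by rw [vec3_dotProduct]; decide))) (by rw [cross_apply]; decide)
      (by rw [vec3_dotProduct, vec3_dotProduct]; decide) p_111 p_m00
    rwa [e] at h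
  have p_mm0 : (∀ y : Fin 3 → ℂ, y ⬝ᵥ (fun i : Fin 3 => (((![-1, -1, 0] : Fin 3 → ℤ) i : ℤ) : ℂ)) = 0 → Q (-(![-1, -1, 0])) (![-1, -1, 0]) *ᵥ y = (Q ![-1, 0, 0] ![1, 0, 0] 1 1) • y + (Q ![-1, 0, 0] ![1, 0, 0] 2 1) • ((fun i : Fin 3 => (((![-1, -1, 0] : Fin 3 → ℤ) i : ℤ) : ℂ)) ⨯₃ y)) := by
    have h := pinned_neg Q hsymm hcol (k := ![1, 1, 0]) (by decide) p_110
    rwa [show (-![1, 1, 0] : Fin 3 → ℤ) = ![-1, -1, 0] by decide] at h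
  have p_m0m : (∀ y : Fin 3 → ℂ, y ⬝ᵥ (fun i : Fin 3 => (((![-1, 0, -1] : Fin 3 → ℤ) i : ℤ) : ℂ)) = 0 → Q (-(![-1, 0, -1])) (![-1, 0, -1]) *ᵥ y = (Q ![-1, 0, 0] ![1, 0, 0] 1 1) • y + (Q ![-1, 0, 0] ![1, 0, 0] 2 1) • ((fun i : Fin 3 => (((![-1, 0, -1] : Fin 3 → ℤ) i : ℤ) : ℂ)) ⨯₃ y)) := by
    have h := pinned_neg Q hsymm hcol (k := ![1, 0, 1]) (by decide) p_101
    rwa [show (-![1, 0, 1] : Fin 3 → ℤ) = ![-1, 0, -1] by decide] at h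
  have p_0mm : (∀ y : Fin 3 → ℂ, y ⬝ᵥ (fun i : Fin 3 => (((![0, -1, -1] : Fin 3 → ℤ) i : ℤ) : ℂ)) = 0 → Q (-(![0, -1, -1])) (![0, -1, -1]) *ᵥ y = (Q ![-1, 0, 0] ![1, 0, 0] 1 1) • y + (Q ![-1, 0, 0] ![1, 0, 0] 2 1) • ((fun i : Fin 3 => (((![0, -1, -1] : Fin 3 → ℤ) i : ℤ) : ℂ)) ⨯₃ y)) := by
    have h := pinned_neg Q hsymm hcol (k := ![0, 1, 1]) (by decide) p_011
    rwa [show (-![0, 1, 1] : Fin 3 → ℤ) = ![0, -1, -1] by decide] at h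
  -- the face diagonals `eᵢ - eⱼ` (equal step, two pairs)
  have p_1m0 : (∀ y : Fin 3 → ℂ, y ⬝ᵥ (fun i : Fin 3 => (((![1, -1, 0] : Fin 3 → ℤ) i : ℤ) : ℂ)) = 0 → Q (-(![1, -1, 0])) (![1, -1, 0]) *ᵥ y = (Q ![-1, 0, 0] ![1, 0, 0] 1 1) • y + (Q ![-1, 0, 0] ![1, 0, 0] 2 1) • ((fun i : Fin 3 => (((![1, -1, 0] : Fin 3 → ℤ) i : ℤ) : ℂ)) ⨯₃ y)) := by
    have e : (![1, 0, 0] + ![0, -1, 0] : Fin 3 → ℤ) = ![1, -1, 0] := by decide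
    have h := pin_sum_two_pairs Q hsymm hrow hcol hpol (k₁ := ![1, 0, 0]) (k₂ := ![0, -1, 0]) (l₁ := ![1, 0, 1])
      (l₂ := ![0, -1, -1]) (hb ![1, 0, 0] (by decide) (by rw [vec3_dotProduct]; decide)) (hb ![0, -1, 0] (by decide) (by rw [vec3_dotProduct]; decide)) (hb ![1, 0, 1] (by decide) (by rw [vec3_dotProduct]; decide)) (hb ![0, -1, -1] (by decide) (by rw [vec3_dotProduct]; decide))
      (by rw [e]; exact (hb ![1, -1, 0] (by decide) (by rw [vec3_dotProduct]; decide))) (by decide) (by rw [cross_apply]; decide) (by rw [cross_apply]; decide)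
      (by rw [cross_apply, cross_apply, e, Matrix.det_fin_three]; decide) p_100 p_0m0 p_101 p_0mm
    rwa [e] at h
  have p_10m : (∀ y : Fin 3 → ℂ, y ⬝ᵥ (fun i : Fin 3 => (((![1, 0, -1] : Fin 3 → ℤ) i : ℤ) : ℂ)) = 0 → Q (-(![1, 0, -1])) (![1, 0, -1]) *ᵥ y = (Q ![-1, 0, 0] ![1, 0, 0] 1 1) • y + (Q ![-1, 0, 0] ![1, 0, 0] 2 1) • ((fun i : Fin 3 => (((![1, 0, -1] : Fin 3 → ℤ) i : ℤ) : ℂ)) ⨯₃ y)) := by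
    have e : (![1, 0, 0] + ![0, 0, -1] : Fin 3 → ℤ) = ![1, 0, -1] := by decide
    have h := pin_sum_two_pairs Q hsymm hrow hcol hpol (k₁ := ![1, 0, 0]) (k₂ := ![0, 0, -1]) (l₁ := ![1, 1, 0])
      (l₂ := ![0, -1, -1]) (hb ![1, 0, 0] (by decide) (by rw [vec3_dotProduct]; decide)) (hb ![0, 0, -1] (by decide) (by rw [vec3_dotProduct]; decide)) (hb ![1, 1, 0] (by decide) (by rw [vec3_dotProduct]; decide)) (hb ![0, -1, -1] (by decide) (by rw [vec3_dotProduct]; decide))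
      (by rw [e]; exact (hb ![1, 0, -1] (by decide) (by rw [vec3_dotProduct]; decide))) (by decide) (by rw [cross_apply]; decide) (by rw [cross_apply]; decide)
      (by rw [cross_apply, cross_apply, e, Matrix.det_fin_three]; decide) p_100 p_00m p_110 p_0mm
    rwa [e] at h
  have p_01m : (∀ y : Fin 3 → ℂ, y ⬝ᵥ (fun i : Fin 3 => (((![0, 1, -1] : Fin 3 → ℤ) i : ℤ) : ℂ)) = 0 → Q (-(![0, 1, -1])) (![0, 1, -1]) *ᵥ y = (Q ![-1, 0, 0] ![1, 0, 0] 1 1) • y + (Q ![-1, 0, 0] ![1, 0, 0] 2 1) • ((fun i : Fin 3 => (((![0, 1, -1] : Fin 3 → ℤ) i : ℤ) : ℂ)) ⨯₃ y)) := by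
    have e : (![0, 1, 0] + ![0, 0, -1] : Fin 3 → ℤ) = ![0, 1, -1] := by decide
    have h := pin_sum_two_pairs Q hsymm hrow hcol hpol (k₁ := ![0, 1, 0]) (k₂ := ![0, 0, -1]) (l₁ := ![1, 1, 0])
      (l₂ := ![-1, 0, -1]) (hb ![0, 1, 0] (by decide) (by rw [vec3_dotProduct]; decide)) (hb ![0, 0, -1] (by decide) (by rw [vec3_dotProduct]; decide)) (hb ![1, 1, 0] (by decide) (by rw [vec3_dotProduct]; decide)) (hb ![-1, 0, -1] (by decide) (by rw [vec3_dotProduct]; decide))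
      (by rw [e]; exact (hb ![0, 1, -1] (by decide) (by rw [vec3_dotProduct]; decide))) (by decide) (by rw [cross_apply]; decide) (by rw [cross_apply]; decide)
      (by rw [cross_apply, cross_apply, e, Matrix.det_fin_three]; decide) p_010 p_00m p_110 p_m0m
    rwa [e] at h
  have p_m10 : (∀ y : Fin 3 → ℂ, y ⬝ᵥ (fun i : Fin 3 => (((![-1, 1, 0] : Fin 3 → ℤ) i : ℤ) : ℂ)) = 0 → Q (-(![-1, 1, 0])) (![-1, 1, 0]) *ᵥ y = (Q ![-1, 0, 0] ![1, 0, 0] 1 1) • y + (Q ![-1, 0, 0] ![1, 0, 0] 2 1) • ((fun i : Fin 3 => (((![-1, 1, 0] : Fin 3 → ℤ) i : ℤ) : ℂ)) ⨯₃ y)) := by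
    have h := pinned_neg Q hsymm hcol (k := ![1, -1, 0]) (by decide) p_1m0
    rwa [show (-![1, -1, 0] : Fin 3 → ℤ) = ![-1, 1, 0] by decide] at h
  have p_m01 : (∀ y : Fin 3 → ℂ, y ⬝ᵥ (fun i : Fin 3 => (((![-1, 0, 1] : Fin 3 → ℤ) i : ℤ) : ℂ)) = 0 → Q (-(![-1, 0, 1])) (![-1, 0, 1]) *ᵥ y = (Q ![-1, 0, 0] ![1, 0, 0] 1 1) • y + (Q ![-1, 0, 0] ![1, 0, 0] 2 1) • ((fun i : Fin 3 => (((![-1, 0, 1] : Fin 3 → ℤ) i : ℤ) : ℂ)) ⨯₃ y)) := by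
    have h := pinned_neg Q hsymm hcol (k := ![1, 0, -1]) (by decide) p_10m
    rwa [show (-![1, 0, -1] : Fin 3 → ℤ) = ![-1, 0, 1] by decide] at h
  have p_0m1 : (∀ y : Fin 3 → ℂ, y ⬝ᵥ (fun i : Fin 3 => (((![0, -1, 1] : Fin 3 → ℤ) i : ℤ) : ℂ)) = 0 → Q (-(![0, -1, 1])) (![0, -1, 1]) *ᵥ y = (Q ![-1, 0, 0] ![1, 0, 0] 1 1) • y + (Q ![-1, 0, 0] ![1, 0, 0] 2 1) • ((fun i : Fin 3 => (((![0, -1, 1] : Fin 3 → ℤ) i : ℤ) : ℂ)) ⨯₃ y)) := by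
    have h := pinned_neg Q hsymm hcol (k := ![0, 1, -1]) (by decide) p_01m
    rwa [show (-![0, 1, -1] : Fin 3 → ℤ) = ![0, -1, 1] by decide] at h
  -- the remaining body diagonals (unequal step)
  have p_11m : (∀ y : Fin 3 → ℂ, y ⬝ᵥ (fun i : Fin 3 => (((![1, 1, -1] : Fin 3 → ℤ) i : ℤ) : ℂ)) = 0 → Q (-(![1, 1, -1])) (![1, 1, -1]) *ᵥ y = (Q ![-1, 0, 0] ![1, 0, 0] 1 1) • y + (Q ![-1, 0, 0] ![1, 0, 0] 2 1) • ((fun i : Fin 3 => (((![1, 1, -1] : Fin 3 → ℤ) i : ℤ) : ℂ)) ⨯₃ y)) := by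
    have e : (![1, 1, 0] + ![0, 0, -1] : Fin 3 → ℤ) = ![1, 1, -1] := by decide
    have h := pin_sum_unequal Q hsymm hrow hcol hpol (k₁ := ![1, 1, 0]) (k₂ := ![0, 0, -1]) (hb ![1, 1, 0] (by decide) (by rw [vec3_dotProduct]; decide))
      (hb ![0, 0, -1] (by decide) (by rw [vec3_dotProduct]; decide)) (by rw [e]; exact (hb ![1, 1, -1] (by decide) (by rw [vec3_dotProduct]; decide))) (by rw [cross_apply]; decide)
      (by rw [vec3_dotProduct, vec3_dotProduct]; decide) p_110 p_00m
    rwa [e] at h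
  have p_1m1 : (∀ y : Fin 3 → ℂ, y ⬝ᵥ (fun i : Fin 3 => (((![1, -1, 1] : Fin 3 → ℤ) i : ℤ) : ℂ)) = 0 → Q (-(![1, -1, 1])) (![1, -1, 1]) *ᵥ y = (Q ![-1, 0, 0] ![1, 0, 0] 1 1) • y + (Q ![-1, 0, 0] ![1, 0, 0] 2 1) • ((fun i : Fin 3 => (((![1, -1, 1] : Fin 3 → ℤ) i : ℤ) : ℂ)) ⨯₃ y)) := by
    have e : (![1, 0, 1] + ![0, -1, 0] : Fin 3 → ℤ) = ![1, -1, 1] := by decide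
    have h := pin_sum_unequal Q hsymm hrow hcol hpol (k₁ := ![1, 0, 1]) (k₂ := ![0, -1, 0]) (hb ![1, 0, 1] (by decide) (by rw [vec3_dotProduct]; decide))
      (hb ![0, -1, 0] (by decide) (by rw [vec3_dotProduct]; decide)) (by rw [e]; exact (hb ![1, -1, 1] (by decide) (by rw [vec3_dotProduct]; decide))) (by rw [cross_apply]; decide)
      (by rw [vec3_dotProduct, vec3_dotProduct]; decide) p_101 p_0m0
    rwa [e] at h
  have p_m11 : (∀ y : Fin 3 → ℂ, y ⬝ᵥ (fun i : Fin 3 => (((![-1, 1, 1] : Fin 3 → ℤ) i : ℤ) : ℂ)) = 0 → Q (-(![-1, 1, 1])) (![-1, 1, 1]) *ᵥ y = (Q ![-1, 0, 0] ![1, 0, 0] 1 1) • y + (Q ![-1, 0, 0] ![1, 0, 0] 2 1) • ((fun i : Fin 3 => (((![-1, 1, 1] : Fin 3 → ℤ) i : ℤ) : ℂ)) ⨯₃ y)) := by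
    have e : (![0, 1, 1] + ![-1, 0, 0] : Fin 3 → ℤ) = ![-1, 1, 1] := by decide
    have h := pin_sum_unequal Q hsymm hrow hcol hpol (k₁ := ![0, 1, 1]) (k₂ := ![-1, 0, 0]) (hb ![0, 1, 1] (by decide) (by rw [vec3_dotProduct]; decide))
      (hb ![-1, 0, 0] (by decide) (by rw [vec3_dotProduct]; decide)) (by rw [e]; exact (hb ![-1, 1, 1] (by decide) (by rw [vec3_dotProduct]; decide))) (by rw [cross_apply]; decide)
      (by rw [vec3_dotProduct, vec3_dotProduct]; decide) p_011 p_m00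
    rwa [e] at h
  have p_mm1 : (∀ y : Fin 3 → ℂ, y ⬝ᵥ (fun i : Fin 3 => (((![-1, -1, 1] : Fin 3 → ℤ) i : ℤ) : ℂ)) = 0 → Q (-(![-1, -1, 1])) (![-1, -1, 1]) *ᵥ y = (Q ![-1, 0, 0] ![1, 0, 0] 1 1) • y + (Q ![-1, 0, 0] ![1, 0, 0] 2 1) • ((fun i : Fin 3 => (((![-1, -1, 1] : Fin 3 → ℤ) i : ℤ) : ℂ)) ⨯₃ y)) := by
    have h := pinned_neg Q hsymm hcol (k := ![1, 1, -1]) (by decide) p_11m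
    rwa [show (-![1, 1, -1] : Fin 3 → ℤ) = ![-1, -1, 1] by decide] at h
  have p_m1m : (∀ y : Fin 3 → ℂ, y ⬝ᵥ (fun i : Fin 3 => (((![-1, 1, -1] : Fin 3 → ℤ) i : ℤ) : ℂ)) = 0 → Q (-(![-1, 1, -1])) (![-1, 1, -1]) *ᵥ y = (Q ![-1, 0, 0] ![1, 0, 0] 1 1) • y + (Q ![-1, 0, 0] ![1, 0, 0] 2 1) • ((fun i : Fin 3 => (((![-1, 1, -1] : Fin 3 → ℤ) i : ℤ) : ℂ)) ⨯₃ y)) := by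
    have h := pinned_neg Q hsymm hcol (k := ![1, -1, 1]) (by decide) p_1m1
    rwa [show (-![1, -1, 1] : Fin 3 → ℤ) = ![-1, 1, -1] by decide] at h
  have p_1mm : (∀ y : Fin 3 → ℂ, y ⬝ᵥ (fun i : Fin 3 => (((![1, -1, -1] : Fin 3 → ℤ) i : ℤ) : ℂ)) = 0 → Q (-(![1, -1, -1])) (![1, -1, -1]) *ᵥ y = (Q ![-1, 0, 0] ![1, 0, 0] 1 1) • y + (Q ![-1, 0, 0] ![1, 0, 0] 2 1) • ((fun i : Fin 3 => (((![1, -1, -1] : Fin 3 → ℤ) i : ℤ) : ℂ)) ⨯₃ y)) := by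
    have h := pinned_neg Q hsymm hcol (k := ![-1, 1, 1]) (by decide) p_m11
    rwa [show (-![-1, 1, 1] : Fin 3 → ℤ) = ![1, -1, -1] by decide] at h
  -- case analysis: `k` is one of the 26 vectors
  have hsq : k 0 * k 0 + k 1 * k 1 + k 2 * k 2 ≤ 3 := by rwa [vec3_dotProduct] at hk3
  have h0 : -1 ≤ k 0 ∧ k 0 ≤ 1 := by
    constructor <;> nlinarith [mul_self_nonneg (k 1), mul_self_nonneg (k 2), mul_self_nonneg (k 0 - 1),
      mul_self_nonneg (k 0 + 1)]
  have h1 : -1 ≤ k 1 ∧ k 1 ≤ 1 := by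
    constructor <;> nlinarith [mul_self_nonneg (k 0), mul_self_nonneg (k 2), mul_self_nonneg (k 1 - 1),
      mul_self_nonneg (k 1 + 1)]
  have h2 : -1 ≤ k 2 ∧ k 2 ≤ 1 := by
    constructor <;> nlinarith [mul_self_nonneg (k 0), mul_self_nonneg (k 1), mul_self_nonneg (k 2 - 1),
      mul_self_nonneg (k 2 + 1)]
  obtain ⟨a, b, c, rfl⟩ : ∃ a b c : ℤ, k = ![a, b, c] := ⟨k 0, k 1, k 2, by ext i; fin_cases i <;> rfl⟩
  simp only [cons_val_zero, cons_val_one, cons_val_two, head_cons, tail_cons] at h0 h1 h2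
  have hk0 := hk.1
  rcases (show a = -1 ∨ a = 0 ∨ a = 1 by omega) with rfl | rfl | rfl <;>
  rcases (show b = -1 ∨ b = 0 ∨ b = 1 by omega) with rfl | rfl | rfl <;>
  rcases (show c = -1 ∨ c = 0 ∨ c = 1 by omega) with rfl | rfl | rfl <;>
  first | assumption | exact absurd (by decide) hk0

end Summit.AnomalousDissipation.AnomalousDissipation.Theorems.MomentParityQuarticGate.AxialQuad

namespace Summit.AnomalousDissipation.AnomalousDissipation.Theorems.MomentParityQuarticGate

-- the summit-side namespace repeats `AnomalousDissipation` by the tree's convention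
set_option linter.dupNamespace false in
/-- **Registered sub-goal `axialQuad_centreBase` of stub S2q** (summary of this file): every wavevector with `0 < |k|² ≤ 3` is pinned. [folklore] -/
theorem axialQuad_centreBase : ∀ (Q : ((Fin 3 → ℤ) → (Fin 3 → ℤ) → Matrix (Fin 3) (Fin 3) ℂ)) (N : ℕ), 2 ≤ N → (∀ a b : Fin 3 → ℤ, Q b a = Matrix.transpose (Q a b)) → (∀ a b : Fin 3 → ℤ, Matrix.vecMul (fun i : Fin 3 => (((a : Fin 3 → ℤ) i : ℤ) : ℂ)) (Q a b) = 0) → (∀ a b : Fin 3 → ℤ, Matrix.mulVec (Q a b) (fun i : Fin 3 => (((b : Fin 3 → ℤ) i : ℤ) : ℂ)) = 0) → (∀ (k₁ k₂ k₃ : Fin 3 → ℤ) (v₁ v₂ v₃ : Fin 3 → ℂ), ((k₁ : Fin 3 → ℤ) ≠ 0 ∧ (k₁) ⬝ᵥ (k₁) ≤ ((N : ℕ) : ℤ) ^ 2) → ((k₂ : Fin 3 → ℤ) ≠ 0 ∧ (k₂) ⬝ᵥ (k₂) ≤ ((N : ℕ) : ℤ) ^ 2) → ((k₃ : Fin 3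 → ℤ) ≠ 0 ∧ (k₃) ⬝ᵥ (k₃) ≤ ((N : ℕ) : ℤ) ^ 2) → v₁ ⬝ᵥ (fun i : Fin 3 => (((k₁ : Fin 3 → ℤ) i : ℤ) : ℂ)) = 0 → v₂ ⬝ᵥ (fun i : Fin 3 => (((k₂ : Fin 3 → ℤ) i : ℤ) : ℂ)) = 0 → v₃ ⬝ᵥ (fun i : Fin 3 => (((k₃ : Fin 3 → ℤ) i : ℤ) : ℂ)) = 0 → (((v₁) ⬝ᵥ (fun i : Fin 3 => (((k₂ : Fin 3 → ℤ) i : ℤ) : ℂ))) • (v₂) + ((v₂) ⬝ᵥ (fun i : Fin 3 => (((k₁ : Fin 3 → ℤ) i : ℤ) : ℂ))) • (v₁) : Fin 3 → ℂ) ⬝ᵥ (Matrix.mulVec (Q (k₁ + k₂) k₃) v₃) + (((v₁) ⬝ᵥ (fun i : Fin 3 => (((k₃ : Fin 3 → ℤ) i : ℤ) : ℂ))) • (v₃) + ((v₃) ⬝ᵥ (fun i : Fin 3 => (((k₁ : Fin 3 → ℤ) i : ℤ) : ℂ))) • (v₁) : Fin 3 → ℂ) ⬝ᵥ (Matrix.mulVec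 (Q (k₁ + k₃) k₂) v₂) + (((v₂) ⬝ᵥ (fun i : Fin 3 => (((k₃ : Fin 3 → ℤ) i : ℤ) : ℂ))) • (v₃) + ((v₃) ⬝ᵥ (fun i : Fin 3 => (((k₂ : Fin 3 → ℤ) i : ℤ) : ℂ))) • (v₂) : Fin 3 → ℂ) ⬝ᵥ (Matrix.mulVec (Q (k₂ + k₃) k₁) v₁) = 0) → ∀ (k : Fin 3 → ℤ), ((k : Fin 3 → ℤ) ≠ 0 ∧ (k) ⬝ᵥ (k) ≤ ((N : ℕ) : ℤ) ^ 2) → k ⬝ᵥ k ≤ 3 → (∀ y : Fin 3 → ℂ, y ⬝ᵥ (fun i : Fin 3 => (((k : Fin 3 → ℤ) i : ℤ) : ℂ)) = 0 → Matrix.mulVec (Q (-(k)) (k)) y = (Q ![-1, 0, 0] ![1, 0, 0] 1 1) • y + (Q ![-1, 0, 0] ![1, 0, 0] 2 1) • (crossProduct (fun i : Fin 3 => (((k : Fin 3 → ℤ) i : ℤ) : ℂ)) y)) :=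
  fun Q _ hN hsymm hrow hcol hpol k hk hk3 => AxialQuad.pinned_of_normSq_le_three Q hN hsymm hrow hcol hpol k hk hk3

end Summit.AnomalousDissipation.AnomalousDissipation.Theorems.MomentParityQuarticGate
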